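import Summits.BirchSwinnertonDyer.BirchSwinnertonDyer.Theorems.EisensteinDepletionAtTwoStarGlueFinPinned
import Summits.BirchSwinnertonDyer.BirchSwinnertonDyer.Theorems.EisensteinDepletionAtTwoStarEulerOrder
import Summits.BirchSwinnertonDyer.BirchSwinnertonDyer.Theorems.EisensteinDepletionAtTwoStarDefs
import Literature.NumberTheory.EllipticCurves.Greenberg1999.TwoTorsionMuInvariant
import Literature.NumberTheory.EllipticCurves.LambdaInvariantCongruenceTransportAtTwo
import Literature.NumberTheory.EllipticCurves.NonEisensteinPrimeOfSurjective
import HarnessLib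

/-!
# Route `EisensteinDepletionAtTwo`, crux E1M `DepletedLambdaLawAtTwoMod` (item stmt-BirchSwinnertonDyer-20341),
# line `star` — (★-GlueFin) BY NAME: `star_glueFin : StarSymbC → StarEisEight → StarEisFin → StarCoreAtTwo`

Cell `bsd-rank2` (HOME run/shared/lean/pub/bsd-rank2/), seat `bsd-rank2-star-p1` GEN 2 (lead of line `star`). THEOREMS ONLY — no
definition, no named fact, no `sorry`. HONEST FRAMING: `Λ`-bookkeeping and elementary `2`-adic estimates serving the registered stub
`stub_starGlueFin : StarSymbC → StarEisEight → StarEisFin → StarCoreAtTwo` of the skeleton `Cruxes/DepletedLambdaLawAtTwoMod/Lines/star.lean`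
v3 (the FINITE-LEVEL reshape of the Eisenstein half of (★): Stevens smoothing `Sm_5^5` on both sides, fixed scale `8`). The
research / analytic stubs (★-SymbC) (mod-2 cusp congruence on the 5.14 habitat), (★-EisEight) («‖v‖₂ ≤ 8⁻¹ on C», the 2-adic form of lit GEN 21 / eng-2 g8) and (★-EisFin)
(smoothed finite-level Eisenstein congruence) are NOT proved here; nothing reads an analytic rank; (★)/E1M are NOT proved; BSD is
not proved by any of this (PARTITION D-0054: none — r_an ≥ 2 axis S0, door T-r3₂).

CONTENT. The registered stub `stub_starGlueFin` of the skeleton v3, with its four statements written out over the tree vocabulary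
`Theorems.DepletionAtTwo.{IsAdmissibleStabData, stabEisCuspDiff, plusCuspDiff, InC, eisNormMeasure}` (`…StarDefs`, p554176),
`frobeniusMinusOne ℓ` unfolded to `GreenbergVatsal2000.frobeniusSeries 2 ℓ − 1` and `SameOnCModTwo` unfolded, proved from
`sq_X_mul_red_pfree_eq_of_smoothedCongruence` (`…StarGlueFinPinned`) at `v = stabEisCuspDiff N_W β`: oddness of `N_W` from good reduction
at `2`, `red H ≠ 0` from the right-hand side of (★-EisFin) in the domain `𝔽₂⟦T⟧` (constant coefficient `1`;
`red_frobeniusSeries_sub_one_ne_zero_two`, `red_pfree_ne_zero`), the exponents `ord_ℓ N ∈ {1,2}` from admissibility, and the shift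
`e ↦ 1 + e` (`(1+T)·(1+T)^e = (1+T)^{1+e}`). In the skeleton: `stub_starGlueFin := by unfold …; exact star_glueFin`.

References: B. Mazur, J. Tate, J. Teitelbaum, Invent. Math. 84 (1986), §I.10–I.13 [MazurTateTeitelbaum1986Invent]; G. Stevens,
*Arithmetic on Modular Curves* (1982), §5.4 [Stevens1982]; L. Washington, GTM 83, §7.1 [Washington1997].
-/

set_option linter.dupNamespace false
set_option autoImplicit false

noncomputable section

open scoped Classical
open scoped MatrixGroups

open Filter Topology CongruenceSubgroup
  Literature.NumberTheory.EllipticCurves Literature.NumberTheory.EllipticCurves.ModularForms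
  Summit.BirchSwinnertonDyer.Rank1Residual.X1.MuLambda

namespace Summit.BirchSwinnertonDyer.BirchSwinnertonDyer.Theorems.DepletionAtTwo

/-! ## §4. The by-name closer of the registered stub `stub_starGlueFin : StarSymbC → StarEisEight → StarEisFin → StarCoreAtTwo`
(skeleton `Cruxes/DepletedLambdaLawAtTwoMod/Lines/star.lean` v3; the four statements written out over the tree vocabulary
`Theorems.DepletionAtTwo.{IsAdmissibleStabData, stabEisCuspDiff, plusCuspDiff, InC, eisNormMeasure}`, `frobeniusMinusOne ℓ`
unfolded to `GreenbergVatsal2000.frobeniusSeries 2 ℓ − 1`, `SameOnCModTwo` unfolded). -/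

section Closer

open _root_.WeierstrassCurve Literature.NumberTheory.EllipticCurves.Greenberg1999

/-- **(★-GlueFin) as registered**: (★-SymbC) → (★-EisEight) → (★-EisFin) → (★-core), by
`sq_X_mul_red_pfree_eq_of_smoothedCongruence` at `v = stabEisCuspDiff N_W β` (oddness of `N_W` from good reduction at `2`;
`red H ≠ 0` from the right-hand side in the domain `𝔽₂⟦T⟧`; the exponents `ord_ℓ N ∈ {1, 2}` from admissibility; the shift
`e ↦ 1 + e` from `(1+T)·(1+T)^e = (1+T)^{1+e}`). [cite: MazurTateTeitelbaum1986Invent, §I.10–I.13] [cite: Stevens1982, §5.4 (PDF pp. 73–74)] -/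
theorem star_glueFin :
    (∀ (W : WeierstrassCurve ℚ) [W.IsElliptic] [W.IsGloballyMinimal] (x : ℚ), IsOrdinaryAt W 2 →
      HasUniqueRationalTwoTorsionX W x →
      ((TwoTorsionRamifiedAtTwo x ∧ ¬ TwoTorsionOdd W x) ∨ (TwoTorsionOdd W x ∧ ¬ TwoTorsionRamifiedAtTwo x)) →
      ∀ ⦃N : ℕ⦄ [NeZero N] (f : CuspForm (CongruenceSubgroup.Gamma0 N) 2), IsNewformOf W f →
        ∃ β : ℕ → ℕ, IsAdmissibleStabData (W.conductorNorm ℤ) β ∧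
          ∃ g g' : ℚ, g ≠ 0 ∧ g' ≠ 0 ∧
            (∀ m a, InC m a → ∃ n n' : ℤ, plusCuspDiff f m a = n * g ∧
              stabEisCuspDiff (W.conductorNorm ℤ) β m a = n' * g' ∧ (n : ZMod 2) = (n' : ZMod 2)) ∧
            (∃ m a, InC m a ∧ ∃ n : ℤ, plusCuspDiff f m a = n * g ∧ Odd n)) →
    (∀ (N : ℕ), Odd N → ∀ (β : ℕ → ℕ), IsAdmissibleStabData N β →
      ∀ (m : ℕ) (a : ℤ), InC m a → ‖((stabEisCuspDiff N β m a : ℚ) : ℚ_[2])‖ ≤ 8⁻¹) →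
    (∀ (N : ℕ), Odd N → ∀ (β : ℕ → ℕ), IsAdmissibleStabData N β →
      ∀ (cg : ℚ_[2]) (G₀ : IwasawaAlgebra 2), G₀ ≠ 0 →
        iwasawaToPowerSeries 2 G₀ = PowerSeries.C cg * klTwoNumerator →
      ∀ (ci : ℚ_[2]) (GI₀ : IwasawaAlgebra 2), GI₀ ≠ 0 →
        iwasawaToPowerSeries 2 GI₀ = PowerSeries.C ci * klTwoNumeratorInv →
        ∃ (H : IwasawaAlgebra 2) (e : ℤ_[2]),
          (∀ k : ℕ, ∀ᶠ n in atTop,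
            ‖distributionRiemannSum (stevensSmoothing 5 (eisNormMeasure N β 8)) k n -
                PowerSeries.coeff k (iwasawaToPowerSeries 2 H)‖ ≤ 2⁻¹) ∧
          red H =
            red (PowerSeries.binomialSeries ℤ_[2] e) * red (pfree G₀) * red (pfree GI₀) *
              ∏ ℓ ∈ N.primeFactors, red (GreenbergVatsal2000.frobeniusSeries 2 ℓ - 1) ^ N.factorization ℓ) →
    (∀ (W : WeierstrassCurve ℚ) [W.IsElliptic] [W.IsGloballyMinimal] (x : ℚ), IsOrdinaryAt W 2 →
      HasUniqueRationalTwoTorsionX W x →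
      ((TwoTorsionRamifiedAtTwo x ∧ ¬ TwoTorsionOdd W x) ∨ (TwoTorsionOdd W x ∧ ¬ TwoTorsionRamifiedAtTwo x)) →
      ∀ ⦃N : ℕ⦄ [NeZero N] (f : CuspForm (CongruenceSubgroup.Gamma0 N) 2), IsNewformOf W f →
      ∀ (c : ℚ) (L₀ : IwasawaAlgebra 2), L₀ ≠ 0 →
        iwasawaToPowerSeries 2 L₀ = PowerSeries.C (c : ℚ_[2]) * padicLFunction f (unitRoot W 2 : ℚ_[2]) →
      ∀ (cg : ℚ_[2]) (G₀ : IwasawaAlgebra 2), G₀ ≠ 0 →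
        iwasawaToPowerSeries 2 G₀ = PowerSeries.C cg * klTwoNumerator →
      ∀ (ci : ℚ_[2]) (GI₀ : IwasawaAlgebra 2), GI₀ ≠ 0 →
        iwasawaToPowerSeries 2 GI₀ = PowerSeries.C ci * klTwoNumeratorInv →
        ∃ e : ℤ_[2],
          PowerSeries.X ^ 2 * red (pfree L₀) =
            red (PowerSeries.binomialSeries ℤ_[2] e) * red (pfree G₀) * red (pfree GI₀) *
              ∏ ℓ ∈ (W.conductorNorm ℤ).primeFactors,
                red (GreenbergVatsal2000.frobeniusSeries 2 ℓ - 1) ^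
                  (if (W.conductorNorm ℤ).factorization ℓ = 1 then 1 else 2)) := by
  intro hS h8 hE W _ _ x hord hx hAB N _ f hf c L₀ hL₀ hι cg G₀ hG₀ hιG ci GI₀ hGI₀ hιGI
  obtain ⟨β, hadm, g, g', hg, hg', hC, hwit⟩ := hS W x hord hx hAB f hf
  -- `N_W` is odd (good reduction at `2`)
  have h2N : ¬ 2 ∣ W.conductorNorm ℤ := not_dvd_conductorNorm_of_hasGoodReductionAtPrime W hord.1
  have hodd : Odd (W.conductorNorm ℤ) := Nat.odd_iff.mpr (Nat.two_dvd_ne_zero.mp h2N)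
  obtain ⟨H, e, hH, hredH⟩ := hE (W.conductorNorm ℤ) hodd β hadm cg G₀ hG₀ hιG ci GI₀ hGI₀ hιGI
  -- `red H ≠ 0`: the right-hand side of (★-EisFin) is a product of nonzero elements of the domain `𝔽₂⟦T⟧`
  have hredHne : red H ≠ 0 := by
    rw [hredH]
    refine mul_ne_zero (mul_ne_zero (mul_ne_zero ?_ (red_pfree_ne_zero hG₀)) (red_pfree_ne_zero hGI₀))
      (Finset.prod_ne_zero_iff.mpr fun ℓ hℓ ↦ pow_ne_zero _ ?_)
    · -- `red((1+T)^e) ≠ 0`: its constant coefficient is `1`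
      intro h
      have h0 := congrArg (PowerSeries.coeff 0) h
      unfold red at h0
      rw [PowerSeries.coeff_map, PowerSeries.binomialSeries_coeff, Ring.choose_zero_right, one_smul, map_one,
        map_zero] at h0
      exact one_ne_zero h0
    · have hℓp : ℓ.Prime := Nat.prime_of_mem_primeFactors hℓ
      have hℓ2 : ℓ ≠ 2 := fun h2 ↦ h2N (h2 ▸ Nat.dvd_of_mem_primeFactors hℓ)
      exact red_frobeniusSeries_sub_one_ne_zero_two hℓp hℓ2
  -- the curve-side glue at `v = stabEisCuspDiff N_W β`
  have hv1 : ∀ m : ℕ, stabEisCuspDiff (W.conductorNorm ℤ) β m 1 = 0 := stabEisCuspDiff_one _ β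
  have hglue := sq_X_mul_red_pfree_eq_of_smoothedCongruence f hord hf (stabEisCuspDiff (W.conductorNorm ℤ) β) hv1 g g'
    hg hg' (fun m a h3 h4 h1 hlt ↦ hC m a ⟨h3, h4, h1, hlt⟩)
    (by
      obtain ⟨m, a, hma, n, hu, hn⟩ := hwit
      exact ⟨m, a, hma, n, hu, hn⟩)
    (fun m a h3 h4 h1 hlt ↦ by
      -- `‖v‖₂ ≤ 8⁻¹ ⇒ ‖v/8‖₂ ≤ 1`
      have h := h8 (W.conductorNorm ℤ) hodd β hadm m a ⟨h3, h4, h1, hlt⟩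
      have h8n : ‖(8 : ℚ_[2])‖ = 8⁻¹ := by
        rw [show (8 : ℚ_[2]) = ((2 : ℕ) : ℚ_[2]) ^ 3 by norm_num, norm_pow, Padic.norm_p]; norm_num
      rw [Rat.cast_div, Rat.cast_ofNat, norm_div, h8n]
      calc ‖((stabEisCuspDiff (W.conductorNorm ℤ) β m a : ℚ) : ℚ_[2])‖ / 8⁻¹ ≤ 8⁻¹ / 8⁻¹ := by gcongr
        _ = 1 := by norm_num) H hH hredHne hL₀ hι
  refine ⟨1 + e, ?_⟩
  have hprod : ∏ ℓ ∈ (W.conductorNorm ℤ).primeFactors,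
      red (GreenbergVatsal2000.frobeniusSeries 2 ℓ - 1) ^ (W.conductorNorm ℤ).factorization ℓ =
      ∏ ℓ ∈ (W.conductorNorm ℤ).primeFactors,
        red (GreenbergVatsal2000.frobeniusSeries 2 ℓ - 1) ^ (if (W.conductorNorm ℤ).factorization ℓ = 1 then 1 else 2) := by
    refine Finset.prod_congr rfl fun ℓ hℓ ↦ ?_
    have hpos : (W.conductorNorm ℤ).factorization ℓ ≠ 0 := by
      rw [← Finsupp.mem_support_iff, Nat.support_factorization]; exact hℓ
    have hle : (W.conductorNorm ℤ).factorization ℓ ≤ 2 := hadm.1 ℓ hℓ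
    by_cases h1 : (W.conductorNorm ℤ).factorization ℓ = 1
    · rw [if_pos h1, h1]
    · rw [if_neg h1]
      have h2 : (W.conductorNorm ℤ).factorization ℓ = 2 := by omega
      rw [h2]
  rw [hglue, hredH, hprod, PowerSeries.binomialSeries_add]
  unfold red
  rw [map_mul]
  ring

end Closer

end Summit.BirchSwinnertonDyer.BirchSwinnertonDyer.Theorems.DepletionAtTwo

end
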